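import Mathlib
import Literature.MathematicalPhysics.QuantumFieldTheory.YangMillsOS
import Literature.MathematicalPhysics.QuantumLattice.WilsonFeynmanHellmann
import HarnessLib

/-!
# Sketch — crux idea `holomorphic-coupling-response` (crux `HypercubicLimit`, stmt-QuantumFields-16154)

First-lemma signatures only (ideation stage; `sorry` in proofs is allowed, statements must elaborate).

The curvature species `P = actionDensity r.ρ` is the observable conjugate to the inverse coupling:
Wilson's weight is `exp(−β ∑ₚ (N − Re tr ρ U_p)) = const · exp(β ∑ₓ P(τₓU))`.  Hence tilting the
Wilson measure by the smeared renormalised curvature field `s · Φ_k(f)` is EXACTLY a local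
modulation of the coupling, `β_k ↦ β_k + s c_k a_k⁴ f(a_k x)`, and for pairwise disjointly
supported real tests `f₀, f₁, …, f_n` the mixed first derivatives in `s₁, …, s_n` at `0` of the
one-point function of `Φ_k(f₀)` in the modulated theory are the truncated `(n+1)`-point lattice
functions of the curvature on the off-diagonal tensor `f₀ ⊗ ⋯ ⊗ f_n` — no contact terms appear.
`HolomorphicCouplingResponse` (C⁺ at order `n`): that one-point function extends holomorphically
to a polydisc of radius `ε` in the complex sources with a bound `B`, uniformly in `k`.
`twoPoint_bound_of_holomorphicResponse`: the Cauchy estimate turns C⁺ (n = 1) into the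
`k`-uniform bound on the truncated two-point function (the `n = 2` case of E0′ on `⁰𝒮`).
-/

noncomputable section

open scoped SchwartzMap
open MeasureTheory ProbabilityTheory Filter Topology
open Literature.MathematicalPhysics.QuantumFieldTheory Literature.MathematicalPhysics.QuantumLattice
open Literature.Probability.LatticeModels

namespace Summit.QuantumFields.YangMills.Cruxes.HypercubicLimit.CouplingResponse

variable {G : Type} [Group G] [TopologicalSpace G] [IsTopologicalGroup G] [CompactSpace G]
  [MeasurableSpace G] [BorelSpace G]

local notation "E4" => EuclideanSpace ℝ (Fin 4)

/-- The scheme's renormalised curvature field at step `k`, smeared with ONE real test function, as a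
function of the torus configuration: `Φ_k(f)(U) = c_k a_k⁴ ∑_{x ∈ box} f(a_k x) (P(τₓŨ) − m_k)`
(verbatim the factor integrated by `latticeSchwinger` for the species `r.curvature`). -/
def curvField (r : LatticeRep G) (sch : SpeciesScheme (YMSpecies G)) (k : ℕ) (f : 𝓢(E4, ℝ))
    (U : GaugeConfig 4 (sch.side k) G) : ℝ :=
  smearedLatticeField r.curvature.F (box 4 (sch.L k)) (sch.a k) (sch.c r.curvature k)
    (sch.m r.curvature k) f (torusLift (sch.side k) U)

/-- The Wilson measure of the scheme at step `k` (torus of side `2L_k+1`, coupling `β_k`). -/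
def wilsonAt (r : LatticeRep G) (sch : SpeciesScheme (YMSpecies G)) (k : ℕ) :
    Measure (GaugeConfig 4 (sch.side k) G) :=
  wilsonMeasure (d := 4) (L := sch.side k) r.ρ (sch.β k)

/-- **Coupling-modulated Wilson measure** (real sources): the exponential tilt of the Wilson
measure by `∑ᵢ sᵢ Φ_k(fᵢ)`, i.e. Wilson's theory with the position-dependent inverse coupling
`β_k + ∑ᵢ sᵢ c_k a_k⁴ fᵢ(a_k x)` (the counterterms `m_k` cancel in the normalisation). -/
def modulatedMeasure (r : LatticeRep G) (sch : SpeciesScheme (YMSpecies G)) (k : ℕ) {n : ℕ}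
    (f : Fin n → 𝓢(E4, ℝ)) (s : Fin n → ℝ) : Measure (GaugeConfig 4 (sch.side k) G) :=
  (wilsonAt r sch k).tilted fun U => ∑ i, s i * curvField r sch k (f i) U

/-- **Complex-source partition function** `Z_k(s) = ∫ exp(∑ᵢ sᵢ Φ_k(fᵢ)) dμ_k`, `s ∈ ℂⁿ`
(entire: the `Φ_k(fᵢ)` are bounded on the compact configuration space). -/
def sourceZ (r : LatticeRep G) (sch : SpeciesScheme (YMSpecies G)) (k : ℕ) {n : ℕ}
    (f : Fin n → 𝓢(E4, ℝ)) (s : Fin n → ℂ) : ℂ :=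
  ∫ U, Complex.exp (∑ i, s i * ((curvField r sch k (f i) U : ℝ) : ℂ)) ∂(wilsonAt r sch k)

/-- **Complex-source one-point function** of `Φ_k(f₀)`:
`⟨Φ_k(f₀)⟩_{k,s} = Z_k(s)⁻¹ ∫ Φ_k(f₀) exp(∑ᵢ sᵢ Φ_k(fᵢ)) dμ_k` (meromorphic in `s`; for real `s`
it is the expectation of the curvature field in the coupling-modulated Wilson theory). -/
def sourceOnePoint (r : LatticeRep G) (sch : SpeciesScheme (YMSpecies G)) (k : ℕ) {n : ℕ}
    (f₀ : 𝓢(E4, ℝ)) (f : Fin n → 𝓢(E4, ℝ)) (s : Fin n → ℂ) : ℂ :=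
  (∫ U, ((curvField r sch k f₀ U : ℝ) : ℂ) *
      Complex.exp (∑ i, s i * ((curvField r sch k (f i) U : ℝ) : ℂ)) ∂(wilsonAt r sch k)) /
    sourceZ r sch k f s

/-- **C⁺ at order `n` — HOLOMORPHIC COUPLING RESPONSE.** For the tests `f₀` (observed field) and
`f₁,…,f_n` (coupling modulations), uniformly in the scheme step `k`: the one-point function of the
renormalised curvature in the complex-modulated Wilson theory is holomorphic on the polydisc
`‖s‖_∞ < ε` (= `Metric.ball 0 ε` for the sup norm on `Fin n → ℂ`) and bounded there by `B`.
(Intended use: `f₀, …, f_n` real Schwartz with pairwise disjoint supports, `B = C₀ C₁ⁿ ∏ |fᵢ|_σ`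
for one Schwartz seminorm, `ε = ε₁/(n+1)`.) -/
def HolomorphicCouplingResponse (r : LatticeRep G) (sch : SpeciesScheme (YMSpecies G)) (n : ℕ)
    (ε B : ℝ) (f₀ : 𝓢(E4, ℝ)) (f : Fin n → 𝓢(E4, ℝ)) : Prop :=
  ∀ k : ℕ, DifferentiableOn ℂ (sourceOnePoint r sch k f₀ f) (Metric.ball 0 ε) ∧
    ∀ s ∈ Metric.ball (0 : Fin n → ℂ) ε, ‖sourceOnePoint r sch k f₀ f s‖ ≤ B

/-- **Fluctuation–response (exact, finite `k`).** The derivative at `0` of the REAL-modulated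
one-point function of `Φ_k(f₀)` in the source of `Φ_k(f₁)` is the covariance — the truncated
lattice two-point function of the renormalised curvature on `f₀ ⊗ f₁` (tree
`hasDerivAt_integral_tilted_eq_covariance`; no contact term when `supp f₀ ∩ supp f₁ = ∅`, and
none is even needed at `n = 1`). -/
theorem hasDerivAt_modulated_onePoint (r : LatticeRep G) (sch : SpeciesScheme (YMSpecies G))
    (k : ℕ) (f₀ f₁ : 𝓢(E4, ℝ)) :
    HasDerivAt (fun t : ℝ => ∫ U, curvField r sch k f₀ U ∂(modulatedMeasure r sch k ![f₁] ![t]))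
      (cov[curvField r sch k f₀, curvField r sch k f₁; wilsonAt r sch k]) 0 := by
  sorry

/-- **FIRST LEMMA of the line (Cauchy transfer, `n = 1`).** Holomorphic coupling response of
order one with radius `ε` and bound `B` gives, for EVERY step `k`, the bound `B/ε` on the truncated
two-point function of the renormalised curvature on `f₀ ⊗ f₁`: the `n = 2` instance of the
`k`-uniform E0′ bound on `⁰𝒮` that the closure of `HypercubicLimit` consumes.  (Proof sketch:
`t ↦ sourceOnePoint … (t·e₁)` is holomorphic on `|t| < ε`, bounded by `B`, its derivative at `0`
is the covariance by `hasDerivAt_modulated_onePoint` and uniqueness of the holomorphic extension;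
Cauchy's estimate `Complex.norm_deriv_le_of_forall_mem_sphere_norm_le` on circles `|t| = ρ < ε`.) -/
theorem twoPoint_bound_of_holomorphicResponse (r : LatticeRep G)
    (sch : SpeciesScheme (YMSpecies G)) {ε B : ℝ} (hε : 0 < ε) {f₀ f₁ : 𝓢(E4, ℝ)}
    (h : HolomorphicCouplingResponse r sch 1 ε B f₀ ![f₁]) (k : ℕ) :
    |cov[curvField r sch k f₀, curvField r sch k f₁; wilsonAt r sch k]| ≤ B / ε := by
  sorry

/-- **Bookkeeping identity**: the covariance above IS the truncated lattice two-point function of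
the statement's `latticeSchwinger` for the constant species string `curvature`. -/
theorem cov_eq_latticeSchwinger_trunc (r : LatticeRep G) (sch : SpeciesScheme (YMSpecies G))
    (k : ℕ) (f₀ f₁ : 𝓢(E4, ℝ)) :
    cov[curvField r sch k f₀, curvField r sch k f₁; wilsonAt r sch k] =
      latticeSchwinger r.ρ sch (fun s => s.F) k 2 (fun _ => r.curvature) ![f₀, f₁] -
        latticeSchwinger r.ρ sch (fun s => s.F) k 1 (fun _ => r.curvature) ![f₀] *
          latticeSchwinger r.ρ sch (fun s => s.F) k 1 (fun _ => r.curvature) ![f₁] := by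
  sorry

/-- **General order (the shape the closure needs).** Order-`n` holomorphic response for all
`(n+1)`-tuples of pairwise disjointly supported real tests, with radius `ε₁/(n+1)` and bound
`C₀ C₁ⁿ ∏ᵢ |fᵢ|` in ONE fixed Schwartz seminorm `(m, l)`, uniformly in `k` — the transfer target
`C⁺` whose Cauchy estimates give `k`-uniform bounds `(n+1)ⁿ⁺¹ C₀ (C₁/ε₁)ⁿ ∏ |fᵢ|` on all truncated
`(n+1)`-point functions on off-diagonal real tensors (E0′ with `(n!)¹` growth). -/
def UniformHolomorphicResponse (r : LatticeRep G) (sch : SpeciesScheme (YMSpecies G))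
    (m l : ℕ) (ε₁ C₀ C₁ : ℝ) : Prop :=
  ∀ (n : ℕ) (f₀ : 𝓢(E4, ℝ)) (f : Fin n → 𝓢(E4, ℝ)),
    (∀ i, Disjoint (tsupport f₀) (tsupport (f i))) →
    (∀ i j, i ≠ j → Disjoint (tsupport (f i)) (tsupport (f j))) →
      HolomorphicCouplingResponse r sch n (ε₁ / (n + 1))
        (C₀ * C₁ ^ n * (SchwartzMap.seminorm ℝ m l f₀) * ∏ i, SchwartzMap.seminorm ℝ m l (f i)) f₀ f

/-- **Connected modulated free energy** (observable-free form): the inclusion–exclusion combination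
`W_k(s) = ∑_{T ⊆ {0,…,n-1}} (−1)^{n−|T|} log Z_k(∑_{i∈T} sᵢ Φ_k(fᵢ))` over sub-families of REAL sources
(each `Z_k` of a real source is a positive real number: `(sourceZ … (real s)).re > 0`).  It vanishes when
any `sᵢ = 0`, every LOCAL functional of the modulation profile cancels in it when the `fᵢ` have pairwise
disjoint supports, and its mixed derivative `∂_{s₀}⋯∂_{s_{n-1}}` at `0` is the joint cumulant
`κ_n(Φ_k(f₀),…,Φ_k(f_{n-1}))` = the truncated lattice `n`-point function on `f₀ ⊗ ⋯ ⊗ f_{n-1}`. -/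
def connFreeEnergy (r : LatticeRep G) (sch : SpeciesScheme (YMSpecies G)) (k : ℕ) {n : ℕ}
    (f : Fin n → 𝓢(E4, ℝ)) (s : Fin n → ℝ) : ℝ :=
  ∑ T : Finset (Fin n), (-1 : ℝ) ^ (n - T.card) *
    Real.log (sourceZ r sch k f (fun i => if i ∈ T then ((s i : ℝ) : ℂ) else 0)).re

/-- **C⁺, observable-free form — HOLOMORPHIC CONNECTED FREE ENERGY.** Uniformly in `k`, the connected
modulated free energy of the source family `f` is the restriction to real points of a function holomorphic
on the complex polydisc of radius `ε` and bounded by `B` there.  ALL `n` curvature fields have become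
coupling modulations: only partition functions of (complex-)modulated Wilson theories remain.  Cauchy:
`|κ_n| ≤ B/εⁿ` (mixed first derivatives on a polydisc). -/
def HolomorphicConnectedFreeEnergy (r : LatticeRep G) (sch : SpeciesScheme (YMSpecies G)) (n : ℕ)
    (ε B : ℝ) (f : Fin n → 𝓢(E4, ℝ)) : Prop :=
  ∀ k : ℕ, ∃ W : (Fin n → ℂ) → ℂ, DifferentiableOn ℂ W (Metric.ball 0 ε) ∧
    (∀ s ∈ Metric.ball (0 : Fin n → ℂ) ε, ‖W s‖ ≤ B) ∧
    ∀ s : Fin n → ℝ, (fun i => ((s i : ℝ) : ℂ)) ∈ Metric.ball (0 : Fin n → ℂ) ε →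
      W (fun i => ((s i : ℝ) : ℂ)) = ((connFreeEnergy r sch k f s : ℝ) : ℂ)

/-- **Cauchy transfer, observable-free form, `n = 2`**: holomorphic connected free energy of the pair
`(f₀, f₁)` bounds the truncated two-point function by `B/ε²` for every `k`. -/
theorem twoPoint_bound_of_holomorphicConnFreeEnergy (r : LatticeRep G)
    (sch : SpeciesScheme (YMSpecies G)) {ε B : ℝ} (hε : 0 < ε) {f₀ f₁ : 𝓢(E4, ℝ)}
    (h : HolomorphicConnectedFreeEnergy r sch 2 ε B ![f₀, f₁]) (k : ℕ) :
    |cov[curvField r sch k f₀, curvField r sch k f₁; wilsonAt r sch k]| ≤ B / ε ^ 2 := by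
  sorry

end Summit.QuantumFields.YangMills.Cruxes.HypercubicLimit.CouplingResponse
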